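import Literature.MathematicalPhysics.StatisticalMechanics.BoltzmannB4HardSpheres

/-!
# Runbook sanity: the three hard-sphere cluster-integral domains of `B₄` (review-runbook, pub-corpus row 47)

Non-vacuity and nesting checks for the definition cards `hardSphereRingFour`, `hardSphereDiamondFour`,
`hardSphereStarFour` (`Literature/MathematicalPhysics/StatisticalMechanics/BoltzmannB4HardSpheres.lean`), the
domains of the route items `RingFourSphere` / `DiamondFourSphere` / `StarFourSphere` of
`Summit.KontsevichZagierPeriods.KontsevichZagierPeriods.Theses.HardSphereVirial` and of the closed statement
`Boltzmann1899_B4_hardSpheres_dim3` (REVIEW-RUNBOOK of the pub-corpus cell, definition cards D23–D25):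

* each domain contains the coincident configuration `r₂ = r₃ = r₄ = 0` (so none is empty) and misses a
  configuration with `|r₂| = 2` (so none is everything);
* more Mayer bonds = smaller set: `C_{K₄} ⊆ C_◇ ⊆ C_{C₄}` (complete star ⊆ diamond ⊆ ring), and both
  inclusions are STRICT, witnessed by an explicit bent chain (in the ring, chord `13` of length `≈ 1.27`)
  and an explicit straight chain (in the diamond, the missing bond `24` has length `1.8`).

Plain kernel facts about the tree definitions; no new mathematics (ops-runbook seat, sanity lemmas through the gate).
-/

noncomputable section

namespace Summit.KontsevichZagierPeriods.HardSphereVirial.RunbookSanity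

open Literature.MathematicalPhysics.StatisticalMechanics

/-- The coincident configuration `r₂ = r₃ = r₄ = r₁ = 0` lies in the ring domain `C_{C₄}`. -/
theorem zero_mem_hardSphereRingFour : (0 : Fin 9 → ℝ) ∈ hardSphereRingFour := by
  simp [hardSphereRingFour]

/-- The coincident configuration lies in the diamond domain `C_◇`. -/
theorem zero_mem_hardSphereDiamondFour : (0 : Fin 9 → ℝ) ∈ hardSphereDiamondFour := by
  simp [hardSphereDiamondFour]

/-- The coincident configuration lies in the complete-star domain `C_{K₄}`. -/
theorem zero_mem_hardSphereStarFour : (0 : Fin 9 → ℝ) ∈ hardSphereStarFour := by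
  simp [hardSphereStarFour]

/-- A configuration with `r₂ = (2, 0, 0)` (bond `12` broken) is outside the ring domain. -/
theorem far_not_mem_hardSphereRingFour : (![2, 0, 0, 0, 0, 0, 0, 0, 0] : Fin 9 → ℝ) ∉ hardSphereRingFour := by
  simp [hardSphereRingFour]

/-- More bonds, smaller domain: the complete star `K₄` (6 bonds) refines the diamond (5 bonds). -/
theorem hardSphereStarFour_subset_diamond : hardSphereStarFour ⊆ hardSphereDiamondFour := by
  intro x hx
  simp only [hardSphereStarFour, hardSphereDiamondFour, Set.mem_setOf_eq] at hx ⊢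
  obtain ⟨h12, h13, h14, h23, _h24, h34⟩ := hx
  exact ⟨h12, h13, h23, h34, h14⟩

/-- The diamond (5 bonds) refines the ring `C₄` (4 bonds). -/
theorem hardSphereDiamondFour_subset_ring : hardSphereDiamondFour ⊆ hardSphereRingFour := by
  intro x hx
  simp only [hardSphereDiamondFour, hardSphereRingFour, Set.mem_setOf_eq] at hx ⊢
  obtain ⟨h12, _h13, h23, h34, h14⟩ := hx
  exact ⟨h12, h23, h34, h14⟩

/-- Hence the complete star refines the ring. -/
theorem hardSphereStarFour_subset_ring : hardSphereStarFour ⊆ hardSphereRingFour :=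
  hardSphereStarFour_subset_diamond.trans hardSphereDiamondFour_subset_ring

/-- The bent chain `r₂ = (0.9, 0, 0)`, `r₃ = (0.9, 0.9, 0)`, `r₄ = (0, 0.9, 0)`: all four ring bonds have
length `0.9 < 1`, so it lies in the ring domain … -/
theorem bentChain_mem_hardSphereRingFour :
    (![0.9, 0, 0, 0.9, 0.9, 0, 0, 0.9, 0] : Fin 9 → ℝ) ∈ hardSphereRingFour := by
  simp [hardSphereRingFour]
  norm_num

/-- … but its chord `13` has length `√1.62 > 1`, so it is NOT in the diamond domain: the inclusion
`C_◇ ⊆ C_{C₄}` is strict. -/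
theorem bentChain_not_mem_hardSphereDiamondFour :
    (![0.9, 0, 0, 0.9, 0.9, 0, 0, 0.9, 0] : Fin 9 → ℝ) ∉ hardSphereDiamondFour := by
  simp [hardSphereDiamondFour]
  norm_num

/-- The straight chain `r₂ = (0.9, 0, 0)`, `r₃ = 0`, `r₄ = (-0.9, 0, 0)` lies in the diamond domain
(bonds `12, 13, 23, 34, 41` of lengths `0.9, 0, 0.9, 0.9, 0.9`) … -/
theorem straightChain_mem_hardSphereDiamondFour :
    (![0.9, 0, 0, 0, 0, 0, -0.9, 0, 0] : Fin 9 → ℝ) ∈ hardSphereDiamondFour := by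
  simp [hardSphereDiamondFour]
  norm_num

/-- … but bond `24` has length `1.8 ≥ 1`, so it is NOT in the complete-star domain: the inclusion
`C_{K₄} ⊆ C_◇` is strict. -/
theorem straightChain_not_mem_hardSphereStarFour :
    (![0.9, 0, 0, 0, 0, 0, -0.9, 0, 0] : Fin 9 → ℝ) ∉ hardSphereStarFour := by
  simp [hardSphereStarFour]
  norm_num

/-- The three domains are pairwise distinct (summary of the two strict inclusions). -/
theorem hardSphere_domains_distinct :
    hardSphereStarFour ≠ hardSphereDiamondFour ∧ hardSphereDiamondFour ≠ hardSphereRingFour := by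
  refine ⟨fun h => straightChain_not_mem_hardSphereStarFour ?_, fun h => bentChain_not_mem_hardSphereDiamondFour ?_⟩
  · rw [h]; exact straightChain_mem_hardSphereDiamondFour
  · rw [h]; exact bentChain_mem_hardSphereRingFour

end Summit.KontsevichZagierPeriods.HardSphereVirial.RunbookSanity

end
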